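import Mathlib
import HarnessLib
import Summits.NavierStokesRegularity.NavierStokesRegularity.Theorems.UnthreadedRigidityDoorUnthreadedRigidityMixedPairWindowRigidityHolds
import Summits.NavierStokesRegularity.NavierStokesRegularity.Theorems.UnthreadedRigidityDoorUnthreadedRigidityThreadingJetsWindowDegreeOne
import Summits.NavierStokesRegularity.NavierStokesRegularity.Theorems.UnthreadedRigidityDoorUnthreadedRigidityVirialHornAngularTwo

/-!
# Route `UnthreadedRigidityDoor`, item `UnthreadedRigidity` (W2, stmt-NavierStokesRegularity-27585) — LINE g12-1 «CO-ZONAL» rung family: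
# ★★ `TwoShellWindowRigidity 1 2` and `TwoShellWindowRigidity 2 1` HOLD UNCONDITIONALLY (two-shell windows of degrees {1,2} are empty)

Prover file (engine-1 g73; `--supports stmt-NavierStokesRegularity-27585 --as helper`; route-independent imports).

`CoZonal.TwoShellWindowRigidity l₁ l₂` is the crux 27585 RESTRICTED to windows whose slices are two-shells over fixed nonzero solid harmonics
`Y₁, Y₂` of degrees `l₁, l₂` with admissible time-dependent profiles.  For `{l₁,l₂} = {1,2}` the solid harmonics are a linear form `⟪a,·⟫`
(`ThreadingJets.exists_eq_inner_of_isSolidHarmonic_one`, `a ≠ 0`) and a quadratic form `yᵀQy` with `Q` traceless symmetric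
(`VirialHorn.exists_quadY_of_isHomogeneous_two` + `VirialHorn.lap3_quadY`, repackaged as a continuous linear map in `exists_quadHarmonic_of_two`),
so the slices are admissible PAIRS `pairShell (H₁ t) (H₂ t) a Q x₀` and `MixedPair.pairWindow_vanishes` (file `…MixedPairWindowRigidityHolds`:
persistence at first order — bridge M for pairs, the pair sphere law, es-p1's cubic law / non-existence / single-shell vanishing) makes the
window vanish identically; the zero window is infinitesimally axisymmetric.  `(2,1)` is `(1,2)` with the summands swapped.

Results: `exists_quadHarmonic_of_two`, `exists_dipoleHarmonic_of_one`, ★★ `twoShellWindowRigidity_one_two : TwoShellWindowRigidity 1 2`,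
★★ `twoShellWindowRigidity_two_one : TwoShellWindowRigidity 2 1` — the `(1,2)` / `(2,1)` entries of `TwoShellWindowRigidityAll` BY NAME, with NO
residual (neither the linked-pair residual R of g12-1 nor O2a′/O2b′/S-H′ of g11-2 is used) — and, a fortiori, the residual itself at these degrees:
`linkedPairWindowRigidity_one_two : LinkedPairWindowRigidity 1 2`, `linkedPairWindowRigidity_two_one : LinkedPairWindowRigidity 2 1`.

HONEST LABEL: RUNGS about SPECIAL hypothetical two-shell windows, closed by showing the class is EMPTY; support for `UnthreadedRigidity` (27585),
which stays OPEN with the door Target, W2 and Navier–Stokes regularity; no summit statement is proved.  MODEL/rung work; 0 kit.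
-/

noncomputable section

-- the summit and its single sub-problem share the name (CONVENTIONS §1), as in every Theorems file
set_option linter.dupNamespace false

namespace Summit.NavierStokesRegularity.NavierStokesRegularity.Theorems.UnthreadedRigidity.MixedPair

open Set Function Filter Topology
open scoped RealInnerProductSpace
open Literature.Analysis Literature.Analysis.FluidPDE
open Literature.Analysis.UnboundedOperators (heatExtension)
open Summit.NavierStokesRegularity.NavierStokesRegularity.Theorems.UnthreadedRigidity.ProfileHorn (E3 quadY)
open Summit.NavierStokesRegularity.NavierStokesRegularity.Theorems.UnthreadedRigidity.VirialHorn
  (e IsSolidHarmonic VirialAdmissible sepShellL exists_quadY_of_isHomogeneous_two lap3_quadY exists_skew_ne_zero)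
open Summit.NavierStokesRegularity.NavierStokesRegularity.Theorems.UnthreadedRigidity.CoZonal (twoShellL TwoShellWindowRigidity
  LinkedPairWindowRigidity)
open Summit.NavierStokesRegularity.NavierStokesRegularity.Theorems.UnthreadedRigidity.ThreadingJets (exists_eq_inner_of_isSolidHarmonic_one)

/-! ## Classification of the harmonics of degrees one and two in the pair vocabulary -/

/-- the continuous linear map of a `3 × 3` matrix in the standard basis: `(L_M y)_i = Σ_j M_{ij} y_j`. -/
theorem exists_clm_of_matrix (M : Matrix (Fin 3) (Fin 3) ℝ) :
    ∃ L : E3 →L[ℝ] E3, ∀ (y : E3) (i : Fin 3), L y i = ∑ j : Fin 3, M i j * y j := by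
  refine ⟨∑ i : Fin 3, ∑ j : Fin 3, M i j • (EuclideanSpace.proj j : E3 →L[ℝ] ℝ).smulRight (e i), fun y i => ?_⟩
  simp only [sum_apply, smul_apply, ContinuousLinearMap.smulRight_apply]
  fin_cases i <;> simp [Fin.sum_univ_three, e, smul_smul]

/-- ★ A SOLID HARMONIC OF DEGREE TWO IS `yᵀQy` WITH `Q` TRACELESS SYMMETRIC (as a continuous linear map). [folklore] -/
theorem exists_quadHarmonic_of_two {Y : E3 → ℝ} (hY : IsSolidHarmonic 2 Y) :
    ∃ Q : E3 →L[ℝ] E3, IsTracelessSymmetric Q ∧ ∀ y : E3, Y y = quadHarmonic Q y := by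
  obtain ⟨⟨P, hPh, hPe⟩, hlap⟩ := hY
  obtain ⟨M, hMs, hMe⟩ := exists_quadY_of_isHomogeneous_two P hPh
  have hYQ : ∀ y : E3, Y y = quadY M y := fun y => by rw [hPe y, hMe y]
  have htr : M 0 0 + M 1 1 + M 2 2 = 0 := by
    have h0 := hlap 0
    rw [show Y = quadY M from funext hYQ, lap3_quadY] at h0
    linarith only [h0]
  have hs : ∀ i j : Fin 3, M j i = M i j := fun i j => by
    have := congrFun (congrFun hMs i) j
    simpa [Matrix.transpose_apply] using this
  obtain ⟨L, hL⟩ := exists_clm_of_matrix M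
  have hinner : ∀ v w : E3, ⟪L v, w⟫ = ∑ i : Fin 3, (∑ j : Fin 3, M i j * v j) * w i := fun v w => by
    rw [real_inner_comm, PiLp.inner_apply]
    simp only [hL, RCLike.inner_apply, conj_trivial]
  refine ⟨L, ⟨fun v w => ?_, ?_⟩, fun y => ?_⟩
  · rw [hinner, real_inner_comm, hinner]
    simp only [Fin.sum_univ_three, hs 1 0, hs 2 0, hs 2 1]
    ring
  · simp only [hinner, Fin.sum_univ_three]
    have he : ∀ i j : Fin 3, (e i : E3) j = if j = i then (1 : ℝ) else 0 := fun i j => by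
      simp [e]
    simp only [he]
    simp
    linarith
  · rw [hYQ, quadHarmonic, hinner]
    simp only [quadY, Fin.sum_univ_three]
    ring

/-- a NONZERO solid harmonic of degree one is `⟪a,·⟫` with `a ≠ 0`. [folklore] -/
theorem exists_dipoleHarmonic_of_one {Y : E3 → ℝ} (hY : IsSolidHarmonic 1 Y) (hne : ∃ y, Y y ≠ 0) :
    ∃ a : E3, a ≠ 0 ∧ ∀ y : E3, Y y = dipoleHarmonic a y := by
  obtain ⟨c, hc, -⟩ := exists_eq_inner_of_isSolidHarmonic_one hY
  obtain ⟨y, hy⟩ := hne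
  refine ⟨c, fun h0 => hy ?_, fun z => hc z⟩
  rw [hc y, h0, inner_zero_left]

/-! ## ★★ The rungs -/

/-- ★★ **`TwoShellWindowRigidity 1 2` HOLDS**: two-shell windows over nonzero solid harmonics of degrees 1 and 2 are pair windows, which VANISH
(`pairWindow_vanishes`); the zero window is infinitesimally axisymmetric (`VirialHorn.exists_skew_ne_zero`). -/
theorem twoShellWindowRigidity_one_two : TwoShellWindowRigidity 1 2 := by
  intro S hS _ u x₀ hcont hdiv hmild hbdd _ Y₁ Y₂ H₁f H₂f hY₁ hY₂ hY₁ne _ hH₁ hH₂ hshape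
  obtain ⟨a, ha, hYa⟩ := exists_dipoleHarmonic_of_one hY₁ hY₁ne
  obtain ⟨Q, hQ, hYQ⟩ := exists_quadHarmonic_of_two hY₂
  have hY₁f : Y₁ = dipoleHarmonic a := funext hYa
  have hY₂f : Y₂ = quadHarmonic Q := funext hYQ
  have hslice : ∀ t ∈ S, PairAdmissible (H₁f t) (H₂f t) a Q ∧ u t = pairShell (H₁f t) (H₂f t) a Q x₀ := fun t ht =>
    ⟨⟨ha, hQ, hH₁ t ht, hH₂ t ht⟩, by rw [hshape t ht, pairShell_eq_twoShellL, hY₁f, hY₂f]⟩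
  have hzero := pairWindow_vanishes hS hcont hdiv hmild hbdd hslice
  obtain ⟨A, hskew, hA0⟩ := exists_skew_ne_zero
  refine ⟨A, hskew, hA0, fun t ht x => ?_⟩
  have hut : u t = fun _ => (0 : E3) := funext (hzero t ht)
  rw [hut]
  simp

/-- ★★ **`TwoShellWindowRigidity 2 1` HOLDS** (the summands swapped). -/
theorem twoShellWindowRigidity_two_one : TwoShellWindowRigidity 2 1 := by
  intro S hS hconn u x₀ hcont hdiv hmild hbdd hunth Y₂ Y₁ H₂f H₁f hY₂ hY₁ hY₂ne hY₁ne hH₂ hH₁ hshape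
  refine twoShellWindowRigidity_one_two S hS hconn u x₀ hcont hdiv hmild hbdd hunth Y₁ Y₂ H₁f H₂f hY₁ hY₂ hY₁ne hY₂ne hH₁ hH₂
    fun t ht => ?_
  rw [hshape t ht]
  funext x
  simp only [twoShellL]
  rw [add_comm]

/-- the RESIDUAL R of LINE g12-1 at `(1,2)` — `LinkedPairWindowRigidity 1 2` — holds a fortiori (its extra hypotheses are not needed). -/
theorem linkedPairWindowRigidity_one_two : LinkedPairWindowRigidity 1 2 :=
  fun S hS hc u x₀ h1 h2 h3 h4 h5 Y₁ Y₂ H₁f H₂f hY₁ hY₂ hn₁ hn₂ _ hH₁ hH₂ hsh _ =>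
    twoShellWindowRigidity_one_two S hS hc u x₀ h1 h2 h3 h4 h5 Y₁ Y₂ H₁f H₂f hY₁ hY₂ hn₁ hn₂ hH₁ hH₂ hsh

/-- the residual R at `(2,1)`. -/
theorem linkedPairWindowRigidity_two_one : LinkedPairWindowRigidity 2 1 :=
  fun S hS hc u x₀ h1 h2 h3 h4 h5 Y₁ Y₂ H₁f H₂f hY₁ hY₂ hn₁ hn₂ _ hH₁ hH₂ hsh _ =>
    twoShellWindowRigidity_two_one S hS hc u x₀ h1 h2 h3 h4 h5 Y₁ Y₂ H₁f H₂f hY₁ hY₂ hn₁ hn₂ hH₁ hH₂ hsh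

end Summit.NavierStokesRegularity.NavierStokesRegularity.Theorems.UnthreadedRigidity.MixedPair

end
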